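import Literature.AlgebraicGeometry.AbelianVarieties.HomogeneousSymmetricDivisorTwoTorsion
import Literature.AlgebraicGeometry.AbelianSchemes.IsLambdaOfAtWitnessCongruence
import HarnessLib

/-!
# `exists_ample` for a descended polarisation from two SYMMETRIC witnesses (`λ̄^c = Λ(𝒪(Θ₀))`, `λ̄² = Λ(𝒪(E))`, `c` odd)

Layer `Literature/AlgebraicGeometry/AbelianSchemes`, namespace `Literature.AlgebraicGeometry.AbelianSchemes.AbelianSchemeOver`.
THEOREMS ONLY.  Cell hodgecm-mathlib (D-0151), Hecke-link socket (B), (X-amp) plan of record (B-plan1 (g14) 22:05:45Z; census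
`CENSUS-Xamp3-existsAmple` §2–§3): the per-point `∃ Θ, Θ.IsAmple ∧ IsLambdaOfAt s D λ̄ Θ` of ★ `Polarization` from
(h2′) `Θ₀` ample, SYMMETRIC, with `λ̄^c = Λ(𝒪(Θ₀))` ((X-amp-2) ★ p747820 + (h1) symmetric `Θ′`), (h3′) `E` SYMMETRIC with
`λ̄² = Λ(𝒪(E))` ((X-amp-1)), `c = 2k+1`.  The glue: `Θ_B := Θ₀ + k•(−E)` (★ `IsLambdaOfAt.bezout`, p748191); `Z := c•Θ_B − Θ₀` is
translation-invariant (both are witnesses of `λ̄^c`: ★ (a-w)′ `IsLambdaOfAt.linEquiv_pullback_translation_sub`, p744200) and symmetric,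
hence `2•Z ∼ 0` (★ (F5) `two_smul_linEquiv_zero_of_translationInvariant_of_symmetric`), i.e. `(2c)•Θ_B ∼ 2•Θ₀`, and ★
`exists_isAmple_isLambdaOfAt_bezout` concludes.  [MumfordAV1970] §8; [MumfordFogartyKirwan1994] Ch. 6 §2 Def. 6.2–6.3.

* **`exists_isAmple_isLambdaOfAt_of_symmetric_witnesses`** (`m = 2`); §2 (ed.2) **`…_of_pow`** for a witness of `λ̄^m`, `c = m·k + 1`
  (the plan of record's `m = 4`, `c = d²`).

## References

* [MumfordAV1970] D. Mumford, *Abelian Varieties* (1970), §8 (pp. 74–75), §6 Application 1 (p. 60).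
* [MumfordFogartyKirwan1994] D. Mumford, J. Fogarty, F. Kirwan, *GIT*, 3rd ed., Ch. 6 §2 Definitions 6.2–6.3 (p. 120).
-/

noncomputable section

universe u

open CategoryTheory CategoryTheory.Limits AlgebraicGeometry MonoidalCategory

namespace Literature.AlgebraicGeometry.AbelianSchemes

open Literature.AlgebraicGeometry.Motives Literature.AlgebraicGeometry.AbelianVarieties Literature.AlgebraicGeometry.Modules
open scoped MonObj

namespace AbelianSchemeOver

variable {S : Scheme.{u}} (A : AbelianSchemeOver S) (D : A.DualPair) {Ω : Type u} [Field Ω] [IsAlgClosed Ω]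
  (s : Spec (.of Ω) ⟶ S)

/-- **`exists_ample` FROM TWO SYMMETRIC WITNESSES** (census §2–§3): at a geometric point `s` with `Ω` algebraically closed, given
`Θ₀` ample and symmetric with `λ̄^c = Λ(𝒪(Θ₀))`, `E` symmetric with `λ̄² = Λ(𝒪(E))`, `c = 2k + 1` (and the standing binders
`[IsReduced S] [IsLocallyNoetherian S]`, `hD : 𝒫|_{A×{ε}} ≅ 𝒪` of ★ (⊗-2)), there is an AMPLE `Θ` with `λ̄ = Λ(𝒪(Θ))` at `s`
— namely `Θ₀ + k•(−E)`. [cite: MumfordAV1970, §8 (pp. 74–75)] [cite: MumfordFogartyKirwan1994, Ch. 6 §2 Definition 6.2–6.3 (p. 120)] -/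
theorem exists_isAmple_isLambdaOfAt_of_symmetric_witnesses [IsReduced S] [IsLocallyNoetherian S]
    (hD : Nonempty ((Scheme.Modules.pullback (DualPair.unitHatSlice D)).obj D.P ≅ SheafOfModules.unit _))
    {lam : A.X ⟶ D.hat.X} [IsMonHom lam] [IsMonHom (lam ^ 2)] {c k : ℕ} (hc : c = 2 * k + 1)
    {Θ₀ E : CartierDivisor (A.fibre s).toAbelianVariety.X.left} (hΘ₀ : Θ₀.IsAmple)
    (h₀ : A.IsLambdaOfAt s D (lam ^ c) Θ₀) (hE : A.IsLambdaOfAt s D (lam ^ 2) E)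
    (hΘ₀sym : (Θ₀.classPullback ((𝟙 (A.fibre s).toAbelianVariety.X)⁻¹ :
      (A.fibre s).toAbelianVariety.X ⟶ (A.fibre s).toAbelianVariety.X).left).LinEquiv Θ₀)
    (hEsym : (E.classPullback ((𝟙 (A.fibre s).toAbelianVariety.X)⁻¹ :
      (A.fibre s).toAbelianVariety.X ⟶ (A.fibre s).toAbelianVariety.X).left).LinEquiv E) :
    ∃ Θ : CartierDivisor (A.fibre s).toAbelianVariety.X.left, Θ.IsAmple ∧ A.IsLambdaOfAt s D lam Θ := by
  haveI : IsIso (((𝟙 (A.fibre s).toAbelianVariety.X)⁻¹ :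
      (A.fibre s).toAbelianVariety.X ⟶ (A.fibre s).toAbelianVariety.X).left) := by
    rw [← (A.fibre s).toAbelianVariety.zsmulPt_neg_one_eq_inv]; infer_instance
  -- `λ̄ = Λ(𝒪(Θ_B))` for `Θ_B := Θ₀ + k•(−E)`, hence `λ̄^c = Λ(𝒪(c•Θ_B))`
  have hB1 : A.IsLambdaOfAt s D lam (Θ₀ + k • (-E)) := IsLambdaOfAt.bezout A D s hD hc h₀ hE
  have hBc : A.IsLambdaOfAt s D (lam ^ c) (c • (Θ₀ + k • (-E))) := IsLambdaOfAt.pow_nsmul A D lam s c hB1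
  -- `Z := c•Θ_B − Θ₀` is translation-invariant …
  have hZ : ∀ P : (A.fibre s).toAbelianVariety.Points Ω,
      (((c • (Θ₀ + k • (-E)) + -Θ₀).pullback ((A.fibre s).toAbelianVariety.translation P).left).LinEquiv
        (c • (Θ₀ + k • (-E)) + -Θ₀)) :=
    fun P => hBc.linEquiv_pullback_translation_sub h₀ P
  -- … and symmetric (classes: `(−1)^*` is a homomorphism on `Ȟ¹` fixing `[Θ₀]`, `[E]`)
  have hι₀ : CechPic.pullback (((𝟙 (A.fibre s).toAbelianVariety.X)⁻¹ :
      (A.fibre s).toAbelianVariety.X ⟶ (A.fibre s).toAbelianVariety.X).left) Θ₀.cechClass = Θ₀.cechClass := by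
    rw [← CartierDivisor.cechClass_classPullback]; exact (CartierDivisor.cechClass_eq_iff_linEquiv _ _).2 hΘ₀sym
  have hιE : CechPic.pullback (((𝟙 (A.fibre s).toAbelianVariety.X)⁻¹ :
      (A.fibre s).toAbelianVariety.X ⟶ (A.fibre s).toAbelianVariety.X).left) E.cechClass = E.cechClass := by
    rw [← CartierDivisor.cechClass_classPullback]; exact (CartierDivisor.cechClass_eq_iff_linEquiv _ _).2 hEsym
  have hsym : ((c • (Θ₀ + k • (-E)) + -Θ₀).classPullback (((𝟙 (A.fibre s).toAbelianVariety.X)⁻¹ :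
      (A.fibre s).toAbelianVariety.X ⟶ (A.fibre s).toAbelianVariety.X).left)).LinEquiv (c • (Θ₀ + k • (-E)) + -Θ₀) := by
    rw [← CartierDivisor.cechClass_eq_iff_linEquiv, CartierDivisor.cechClass_classPullback]
    simp only [CartierDivisor.cechClass_add, cechClass_smul', cechClass_neg_eq_inv', map_mul, map_pow, map_inv, hι₀, hιE]
  -- `2•Z ∼ 0`, i.e. `(2c)•Θ_B ∼ 2•Θ₀`
  have h2Z := two_smul_linEquiv_zero_of_translationInvariant_of_symmetric (A.fibre s).toAbelianVariety
    (c • (Θ₀ + k • (-E)) + -Θ₀) hZ hsym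
  have h2 : ((2 * c) • (Θ₀ + k • (-E))).LinEquiv (2 • Θ₀) := smul_linEquiv_smul_of_sub_two_torsion _ Θ₀ c h2Z
  exact A.exists_isAmple_isLambdaOfAt_bezout D s hD hc hΘ₀ h₀ hE h2

end AbelianSchemeOver

/-! ### §2 General exponent (appended 2026-08-29, B-p15 (g10), ed.2): witnesses of `λ̄^c` and `λ̄^m`, `c = m·k + 1` -/

namespace AbelianSchemeOver

variable {S : Scheme.{u}} (A : AbelianSchemeOver S) (D : A.DualPair) {Ω : Type u} [Field Ω] [IsAlgClosed Ω]
  (s : Spec (.of Ω) ⟶ S)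

/-- **`exists_ample` FROM TWO SYMMETRIC WITNESSES, general exponent** (the (X-amp) plan with B-p05 (g15)'s symmetrised
witness `E₄ = E + (−1)^*E` of `λ̄⁴`: `m = 4`, `c = d² ≡ 1 (mod 8)`): given `Θ₀` ample symmetric with `λ̄^c = Λ(𝒪(Θ₀))`,
`E` symmetric with `λ̄^m = Λ(𝒪(E))`, `c = m·k + 1`, there is an AMPLE `Θ` with `λ̄ = Λ(𝒪(Θ))` at `s` (`Θ := Θ₀ + k•(−E)`;
`Z := c•Θ − Θ₀` is translation-invariant and symmetric, hence `2`-torsion ★ (F5), so `(2c)•Θ ∼ 2•Θ₀` is ample).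
[cite: MumfordAV1970, §8 (pp. 74–75)] [cite: MumfordFogartyKirwan1994, Ch. 6 §2 Definition 6.2–6.3 (p. 120)] -/
theorem exists_isAmple_isLambdaOfAt_of_symmetric_witnesses_of_pow [IsReduced S] [IsLocallyNoetherian S]
    (hD : Nonempty ((Scheme.Modules.pullback (DualPair.unitHatSlice D)).obj D.P ≅ SheafOfModules.unit _))
    {lam : A.X ⟶ D.hat.X} [IsMonHom lam] {m : ℕ} [IsMonHom (lam ^ m)] {c k : ℕ} (hc : c = m * k + 1)
    {Θ₀ E : CartierDivisor (A.fibre s).toAbelianVariety.X.left} (hΘ₀ : Θ₀.IsAmple)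
    (h₀ : A.IsLambdaOfAt s D (lam ^ c) Θ₀) (hE : A.IsLambdaOfAt s D (lam ^ m) E)
    (hΘ₀sym : (Θ₀.classPullback ((𝟙 (A.fibre s).toAbelianVariety.X)⁻¹ :
      (A.fibre s).toAbelianVariety.X ⟶ (A.fibre s).toAbelianVariety.X).left).LinEquiv Θ₀)
    (hEsym : (E.classPullback ((𝟙 (A.fibre s).toAbelianVariety.X)⁻¹ :
      (A.fibre s).toAbelianVariety.X ⟶ (A.fibre s).toAbelianVariety.X).left).LinEquiv E) :
    ∃ Θ : CartierDivisor (A.fibre s).toAbelianVariety.X.left, Θ.IsAmple ∧ A.IsLambdaOfAt s D lam Θ := by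
  haveI : IsIso (((𝟙 (A.fibre s).toAbelianVariety.X)⁻¹ :
      (A.fibre s).toAbelianVariety.X ⟶ (A.fibre s).toAbelianVariety.X).left) := by
    rw [← (A.fibre s).toAbelianVariety.zsmulPt_neg_one_eq_inv]; infer_instance
  have hB1 : A.IsLambdaOfAt s D lam (Θ₀ + k • (-E)) := IsLambdaOfAt.bezout_of_pow A D s hD hc h₀ hE
  have hBc : A.IsLambdaOfAt s D (lam ^ c) (c • (Θ₀ + k • (-E))) := IsLambdaOfAt.pow_nsmul A D lam s c hB1
  have hZ : ∀ P : (A.fibre s).toAbelianVariety.Points Ω,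
      (((c • (Θ₀ + k • (-E)) + -Θ₀).pullback ((A.fibre s).toAbelianVariety.translation P).left).LinEquiv
        (c • (Θ₀ + k • (-E)) + -Θ₀)) :=
    fun P => hBc.linEquiv_pullback_translation_sub h₀ P
  have hι₀ : CechPic.pullback (((𝟙 (A.fibre s).toAbelianVariety.X)⁻¹ :
      (A.fibre s).toAbelianVariety.X ⟶ (A.fibre s).toAbelianVariety.X).left) Θ₀.cechClass = Θ₀.cechClass := by
    rw [← CartierDivisor.cechClass_classPullback]; exact (CartierDivisor.cechClass_eq_iff_linEquiv _ _).2 hΘ₀sym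
  have hιE : CechPic.pullback (((𝟙 (A.fibre s).toAbelianVariety.X)⁻¹ :
      (A.fibre s).toAbelianVariety.X ⟶ (A.fibre s).toAbelianVariety.X).left) E.cechClass = E.cechClass := by
    rw [← CartierDivisor.cechClass_classPullback]; exact (CartierDivisor.cechClass_eq_iff_linEquiv _ _).2 hEsym
  have hsym : ((c • (Θ₀ + k • (-E)) + -Θ₀).classPullback (((𝟙 (A.fibre s).toAbelianVariety.X)⁻¹ :
      (A.fibre s).toAbelianVariety.X ⟶ (A.fibre s).toAbelianVariety.X).left)).LinEquiv (c • (Θ₀ + k • (-E)) + -Θ₀) := by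
    rw [← CartierDivisor.cechClass_eq_iff_linEquiv, CartierDivisor.cechClass_classPullback]
    simp only [CartierDivisor.cechClass_add, cechClass_smul', cechClass_neg_eq_inv', map_mul, map_pow, map_inv, hι₀, hιE]
  have h2Z := two_smul_linEquiv_zero_of_translationInvariant_of_symmetric (A.fibre s).toAbelianVariety
    (c • (Θ₀ + k • (-E)) + -Θ₀) hZ hsym
  have h2 : ((2 * c) • (Θ₀ + k • (-E))).LinEquiv (2 • Θ₀) := smul_linEquiv_smul_of_sub_two_torsion _ Θ₀ c h2Z
  exact A.exists_isAmple_isLambdaOfAt_bezout_of_pow D s hD hc hΘ₀ h₀ hE h2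

end AbelianSchemeOver

end Literature.AlgebraicGeometry.AbelianSchemes

end
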